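import Mathlib
import Summits.NavierStokesRegularity.NavierStokesRegularity.Theorems.EulerZoomLiouvillePowerGaugeEulerLiouvilleWindowCubic
import HarnessLib

/-!
# The window cubic bound from an A.E.-IN-TIME SLICE ENERGY bound and the `E`-gauge
# (crux `EulerZoomLiouville.PowerGaugeEulerLiouville` = stmt-NavierStokesRegularity-19832, lead's line `birth`)

Route `EulerZoomLiouville` (NavierStokesRegularity).  `…WindowCubic.lean` bounds `∫∫_{(α,β)×B_a}|u|³` for a member of
Seregin's class using the `A`-gauge on every slice (`∫_{B_a}|u(s)|² ≤ c a^{1−2ρ}`) and the `E`-gauge.  For the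
FINITE-ENERGY part of the class (`∫_{ℝ³}|u(s)|² ≤ E₀` for all `s`), the same proof with the slice bound `A₀ = E₀` gives a
BETTER large-scale rate (`a^{3/4−3ρ/4}` instead of `a^{3/2−9ρ/4}`), which makes the window flux integrable for EVERY
`ρ ≥ 0` (next files).  This file is the a.e.-in-time variant of `exists_lintegral_cube_window_ball_le_of_sliceEnergy` (`…FiniteEnergyCubic`),
needed for the BOOTSTRAP IN SCALE of the flux strata (the slice bound produced by the energy inequality from an a.e.
start holds only for a.e. later time; see the lead report of stmt-19832, successor target S1):

* `exists_lintegral_cube_window_ball_le_of_sliceEnergy_ae` — hypothesis `∫_{B_a}|u(s)|² ≤ A₀` for a.e. `s ∈ (α,β)` only; absolute `K` with: for `u` with weak gradient `H` on the slab,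
  the `E`-gauge `a^ρ E(a;0) ≤ c`, a window `−a² ≤ α < β ≤ 0` and ANY slice bound `∫_{B_a}|u(s)|² ≤ A₀ < ∞` (`s ∈ (α,β)`):
  `∫∫_{(α,β)×B_a} |u|³ ≤ K [A₀^{3/4} (c a^{1−ρ})^{3/4} (β−α)^{1/4} + (β−α) |B_a|^{−1/2} A₀^{3/2}]`.
  Proof verbatim `exists_lintegral_cube_window_ball_le` (slice-wise Sobolev interpolation `lintegral_cube_le_ball_explicit`,
  Hölder `3/4` in time, the `E`-gauge), with the `A`-gauge slice bound replaced by the hypothesis.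

WHAT THIS IS NOT: not NS, not the open core; bookkeeping `--supports` stmt-19832. [folklore]
-/

noncomputable section

set_option linter.dupNamespace false

open MeasureTheory Set Filter Topology Metric Function TopologicalSpace Module
open scoped ENNReal NNReal

namespace Summit.NavierStokesRegularity.NavierStokesRegularity.Theorems.PowerGaugeEulerLiouville

open Literature.Analysis Literature.Analysis.FunctionSpaces Literature.Analysis.FluidPDE

/-- **The window cubic bound from an a.e.-in-time slice energy bound.**  There is an absolute `K` such that for every field `u`
with weak spatial gradient `H` on the slab `(−∞,0) × ℝ³` obeying the `E`-gauge `a^ρ E(a;0) ≤ c` (all `a > 0`), every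
radius `a > 0`, window `−a² ≤ α < β ≤ 0` and slice bound `∫_{B(0,a)}|u(s)|² ≤ A₀ < ∞` for a.e. `s ∈ (α,β)`:
`∫∫_{(α,β)×B(0,a)} |u|³ ≤ K · [ A₀^{3/4} (c a^{1−ρ})^{3/4} (β−α)^{1/4} + (β−α) |B_a|^{−1/2} A₀^{3/2} ]`. [folklore] -/
theorem exists_lintegral_cube_window_ball_le_of_sliceEnergy_ae :
    ∃ K : ℝ≥0∞, K ≠ ⊤ ∧ ∀ (ρ : ℝ) (u : ℝ → EuclideanSpace ℝ (Fin 3) → EuclideanSpace ℝ (Fin 3))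
      (H : ℝ → EuclideanSpace ℝ (Fin 3) → EuclideanSpace ℝ (Fin 3) →L[ℝ] EuclideanSpace ℝ (Fin 3)) (c : ℝ≥0)
      (A₀ : ℝ≥0∞), A₀ ≠ ⊤ →
      HasWeakSpatialGradientOn (slab (EuclideanSpace ℝ (Fin 3)) (Iio 0) isOpen_Iio) u H →
      (∀ a : ℝ, 0 < a → ENNReal.ofReal (a ^ ρ) * cknE a (0 : ℝ × EuclideanSpace ℝ (Fin 3)) H ≤ (c : ℝ≥0∞)) →
      ∀ (a α β : ℝ), 0 < a → -(a ^ 2) ≤ α → α < β → β ≤ 0 →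
        (∀ᵐ s ∂(volume.restrict (Ioo α β)), ∫⁻ x in ball (0 : EuclideanSpace ℝ (Fin 3)) a, ‖u s x‖ₑ ^ 2 ≤ A₀) →
        ∫⁻ z in Ioo α β ×ˢ ball (0 : EuclideanSpace ℝ (Fin 3)) a, ‖u z.1 z.2‖ₑ ^ (3 : ℕ) ≤
          K * (A₀ ^ (3 / 4 : ℝ) * ENNReal.ofReal (c * a ^ (1 - ρ)) ^ (3 / 4 : ℝ) *
                  ENNReal.ofReal (β - α) ^ (1 / 4 : ℝ) +
               ENNReal.ofReal (β - α) * (volume (ball (0 : EuclideanSpace ℝ (Fin 3)) a))⁻¹ ^ (1 / 2 : ℝ) *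
                  A₀ ^ (3 / 2 : ℝ)) := by
  obtain ⟨C, hC⟩ := lintegral_cube_le_ball_explicit
  have hKtop : (2 : ℝ≥0∞) ^ (1 / 2 : ℝ) * max ((C : ℝ≥0∞) ^ (3 / 2 : ℝ)) 1 ≠ ⊤ :=
    ENNReal.mul_ne_top (ENNReal.rpow_ne_top_of_nonneg (by norm_num) ENNReal.ofNat_ne_top)
      (max_lt (ENNReal.rpow_lt_top_of_nonneg (by norm_num) ENNReal.coe_ne_top) ENNReal.one_lt_top).ne
  refine ⟨2 ^ (1 / 2 : ℝ) * max ((C : ℝ≥0∞) ^ (3 / 2 : ℝ)) 1, hKtop, ?_⟩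
  intro ρ u H c A₀ hA₀t hH hE a α β ha hα hαβ hβ hA0s'
  set B : Set (EuclideanSpace ℝ (Fin 3)) := ball (0 : EuclideanSpace ℝ (Fin 3)) a with hB
  set W : Set ℝ := Ioo α β with hW
  set E₀ : ℝ≥0∞ := ENNReal.ofReal (c * a ^ (1 - ρ)) with hE₀
  have hWneg : W ⊆ Iio 0 := fun s hs => lt_of_lt_of_le hs.2 hβ
  have hWQ : W ⊆ Ioo (-(a ^ 2)) 0 := fun s hs => ⟨lt_of_le_of_lt hα hs.1, hWneg hs⟩
  -- (1) the slice energy bound on the window (hypothesis, a.e. in time)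
  have hA0s : ∀ᵐ s ∂(volume.restrict W), ∫⁻ x in B, ‖u s x‖ₑ ^ 2 ≤ A₀ := hA0s'
  -- (2) the `E`-gauge on the window: `∫_W e(s) ds ≤ E₀`
  set F : ℝ × EuclideanSpace ℝ (Fin 3) → ℝ≥0∞ := fun q => ENNReal.ofReal (frobeniusNormSq (H q.1 q.2)) with hF
  set e : ℝ → ℝ≥0∞ := fun s => ∫⁻ x in B, F (s, x) with he
  have hHmeas : AEStronglyMeasurable (uncurry H)
      (volume.restrict (Iio (0 : ℝ) ×ˢ (univ : Set (EuclideanSpace ℝ (Fin 3))))) := by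
    have := hH.locallyIntegrableOn_grad.aestronglyMeasurable
    simpa [slab] using this
  have hFmeas : AEMeasurable F (volume.restrict (W ×ˢ B)) :=
    ((ENNReal.continuous_ofReal.comp LerayHopfProofs.continuous_frobeniusNormSq).comp_aestronglyMeasurable
      (hHmeas.mono_measure (Measure.restrict_mono (prod_mono hWneg (subset_univ _)) le_rfl))).aemeasurable
  have hEW : ∫⁻ s in W, e s ≤ E₀ := by
    rw [he, ← setLIntegral_prod_eq hFmeas]
    refine (lintegral_mono_set (prod_mono hWQ Subset.rfl)).trans ?_
    exact lintegral_window_ball_le_of_gaugeE hE ha le_rfl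
  -- (3) good slices: weak derivative on the ball, finite `e(s)`
  have hQ : parabolicCylinderOpens a (0 : ℝ × EuclideanSpace ℝ (Fin 3)) ≤
      slab (EuclideanSpace ℝ (Fin 3)) (Iio 0) isOpen_Iio := by
    intro z hz
    rw [mem_slab]
    have := (mem_parabolicCylinder.1 hz).1.2
    simpa using this
  have hslice : ∀ᵐ s ∂(volume.restrict W),
      HasWeakFDerivOn (⟨B, isOpen_ball⟩ : Opens (EuclideanSpace ℝ (Fin 3))) volume (u s) (H s) := by
    have h1 := (hH.mono hQ).ae_hasWeakFDerivOn_ball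
    simp only [Prod.fst_zero, Prod.snd_zero, zero_sub] at h1
    exact ae_restrict_of_ae_restrict_of_subset hWQ h1
  have hemeas : AEMeasurable e (volume.restrict W) := by
    have := hFmeas
    rw [show (volume : Measure (ℝ × EuclideanSpace ℝ (Fin 3))).restrict (W ×ˢ B) =
      (volume.restrict W).prod (volume.restrict B) by rw [Measure.volume_eq_prod, Measure.prod_restrict]] at this
    exact this.lintegral_prod_right'
  have hefin : ∀ᵐ s ∂(volume.restrict W), e s < ⊤ :=
    ae_lt_top' hemeas (ne_top_of_le_ne_top ENNReal.ofReal_ne_top hEW)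
  -- (4) the slice bound `∫_B ‖u s‖³ ≤ 2^{1/2}(C^{3/2} A₀^{3/4} e(s)^{3/4} + |B|^{-1/2} A₀^{3/2})`
  have hsl : ∀ᵐ s ∂(volume.restrict W), ∫⁻ x in B, ‖u s x‖ₑ ^ (3 : ℕ) ≤
      2 ^ (1 / 2 : ℝ) * ((C : ℝ≥0∞) ^ (3 / 2 : ℝ) * (A₀ ^ (3 / 4 : ℝ) * e s ^ (3 / 4 : ℝ)) +
        (volume B)⁻¹ ^ (1 / 2 : ℝ) * A₀ ^ (3 / 2 : ℝ)) := by
    have hWmem : ∀ᵐ s ∂(volume.restrict W), s ∈ W := ae_restrict_mem measurableSet_Ioo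
    filter_upwards [hslice, hefin, hWmem, hA0s] with s hs hes hsW hA0sW
    -- `L²` memberships of the slice and of its gradient on `B`
    have hum : AEStronglyMeasurable (u s) (volume.restrict B) := hs.locallyIntegrableOn.aestronglyMeasurable
    have hgm : AEStronglyMeasurable (H s) (volume.restrict B) := hs.locallyIntegrableOn_deriv.aestronglyMeasurable
    have hf2 : eLpNorm (u s) 2 (volume.restrict B) ≤ A₀ ^ (1 / 2 : ℝ) := by
      rw [eLpNorm_eq_lintegral_rpow_enorm_toReal (by norm_num) (by norm_num)]
      simp only [ENNReal.toReal_ofNat, one_div]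
      refine ENNReal.rpow_le_rpow ?_ (by norm_num)
      refine le_trans (le_of_eq (lintegral_congr fun x => ?_)) hA0sW
      rw [← ENNReal.rpow_natCast]; norm_num
    have hg2 : eLpNorm (H s) 2 (volume.restrict B) ≤ e s ^ (1 / 2 : ℝ) := by
      rw [eLpNorm_eq_lintegral_rpow_enorm_toReal (by norm_num) (by norm_num)]
      simp only [ENNReal.toReal_ofNat, one_div]
      refine ENNReal.rpow_le_rpow (lintegral_mono fun x => ?_) (by norm_num)
      simp only [hF]
      rw [show ‖H s x‖ₑ ^ (2 : ℝ) = ‖H s x‖ₑ ^ (2 : ℕ) by rw [← ENNReal.rpow_natCast]; norm_num,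
        ← ofReal_norm, ← ENNReal.ofReal_pow (norm_nonneg _)]
      exact ENNReal.ofReal_le_ofReal (sq_opNorm_le_frobeniusNormSq _)
    have hfMem : MemLp (u s) 2 (volume.restrict B) :=
      ⟨hum, lt_of_le_of_lt hf2 (ENNReal.rpow_lt_top_of_nonneg (by norm_num) hA₀t)⟩
    have hgMem : MemLp (H s) 2 (volume.restrict B) :=
      ⟨hgm, lt_of_le_of_lt hg2 (ENNReal.rpow_lt_top_of_nonneg (by norm_num) hes.ne)⟩
    have h1 := hC 0 a ha (u s) (H s) hfMem hgMem hs
    refine h1.trans ?_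
    -- monotonicity in the two norms, then `(x + y)^{3/2} ≤ 2^{1/2} (x^{3/2} + y^{3/2})`
    have h2 : eLpNorm (u s) 2 (volume.restrict B) ^ (3 / 2 : ℝ) *
        ((C : ℝ≥0∞) * eLpNorm (H s) 2 (volume.restrict B) +
          (volume B)⁻¹ ^ (1 / 3 : ℝ) * eLpNorm (u s) 2 (volume.restrict B)) ^ (3 / 2 : ℝ) ≤
        (A₀ ^ (1 / 2 : ℝ)) ^ (3 / 2 : ℝ) *
          ((C : ℝ≥0∞) * e s ^ (1 / 2 : ℝ) + (volume B)⁻¹ ^ (1 / 3 : ℝ) * A₀ ^ (1 / 2 : ℝ)) ^ (3 / 2 : ℝ) := by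
      gcongr
    refine h2.trans ?_
    have h3 := ENNReal.rpow_add_le_mul_rpow_add_rpow ((C : ℝ≥0∞) * e s ^ (1 / 2 : ℝ))
      ((volume B)⁻¹ ^ (1 / 3 : ℝ) * A₀ ^ (1 / 2 : ℝ)) (p := 3 / 2) (by norm_num)
    rw [show (3 / 2 : ℝ) - 1 = 1 / 2 by norm_num] at h3
    refine (mul_le_mul' le_rfl h3).trans (le_of_eq ?_)
    -- exponent algebra
    have eA : (A₀ ^ (1 / 2 : ℝ)) ^ (3 / 2 : ℝ) = A₀ ^ (3 / 4 : ℝ) := by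
      rw [← ENNReal.rpow_mul]; norm_num
    have eCe : ((C : ℝ≥0∞) * e s ^ (1 / 2 : ℝ)) ^ (3 / 2 : ℝ) = (C : ℝ≥0∞) ^ (3 / 2 : ℝ) * e s ^ (3 / 4 : ℝ) := by
      rw [ENNReal.mul_rpow_of_nonneg _ _ (by norm_num), ← ENNReal.rpow_mul]; norm_num
    have eVA : ((volume B)⁻¹ ^ (1 / 3 : ℝ) * A₀ ^ (1 / 2 : ℝ)) ^ (3 / 2 : ℝ) =
        (volume B)⁻¹ ^ (1 / 2 : ℝ) * A₀ ^ (3 / 4 : ℝ) := by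
      rw [ENNReal.mul_rpow_of_nonneg _ _ (by norm_num), ← ENNReal.rpow_mul, ← ENNReal.rpow_mul]; norm_num
    have eAA : A₀ ^ (3 / 4 : ℝ) * A₀ ^ (3 / 4 : ℝ) = A₀ ^ (3 / 2 : ℝ) := by
      rw [← ENNReal.rpow_add_of_nonneg _ _ (by norm_num) (by norm_num)]; norm_num
    rw [eA, eCe, eVA]
    rw [show A₀ ^ (3 / 4 : ℝ) * (2 ^ (1 / 2 : ℝ) * ((C : ℝ≥0∞) ^ (3 / 2 : ℝ) * e s ^ (3 / 4 : ℝ) +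
        (volume B)⁻¹ ^ (1 / 2 : ℝ) * A₀ ^ (3 / 4 : ℝ))) =
      2 ^ (1 / 2 : ℝ) * ((C : ℝ≥0∞) ^ (3 / 2 : ℝ) * (A₀ ^ (3 / 4 : ℝ) * e s ^ (3 / 4 : ℝ)) +
        (volume B)⁻¹ ^ (1 / 2 : ℝ) * (A₀ ^ (3 / 4 : ℝ) * A₀ ^ (3 / 4 : ℝ))) by ring, eAA]
  -- (5) integrate over the window (Tonelli, Hölder 3/4 in time, the `E`-gauge)
  have humeas : AEMeasurable (fun z : ℝ × EuclideanSpace ℝ (Fin 3) => ‖u z.1 z.2‖ₑ ^ (3 : ℕ))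
      (volume.restrict (W ×ˢ B)) := by
    have hum : AEStronglyMeasurable (uncurry u)
        (volume.restrict (Iio (0 : ℝ) ×ˢ (univ : Set (EuclideanSpace ℝ (Fin 3))))) := by
      have := hH.locallyIntegrableOn.aestronglyMeasurable
      simpa [slab] using this
    exact ((hum.mono_measure (Measure.restrict_mono (prod_mono hWneg (subset_univ _)) le_rfl)).aemeasurable.enorm.pow_const 3)
  have hW34 : ∫⁻ s in W, e s ^ (3 / 4 : ℝ) ≤ E₀ ^ (3 / 4 : ℝ) * ENNReal.ofReal (β - α) ^ (1 / 4 : ℝ) := by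
    have h1 := lintegral_rpow_three_quarters_le_mul (volume.restrict W) hemeas
    rw [Measure.restrict_apply_univ, hW, Real.volume_Ioo] at h1
    exact h1.trans (by gcongr)
  -- constants of the slice bound
  set K₁ : ℝ≥0∞ := 2 ^ (1 / 2 : ℝ) * (C : ℝ≥0∞) ^ (3 / 2 : ℝ) * A₀ ^ (3 / 4 : ℝ) with hK₁
  set K₂ : ℝ≥0∞ := 2 ^ (1 / 2 : ℝ) * (volume B)⁻¹ ^ (1 / 2 : ℝ) * A₀ ^ (3 / 2 : ℝ) with hK₂
  have hsl' : ∀ᵐ s ∂(volume.restrict W), ∫⁻ x in B, ‖u s x‖ₑ ^ (3 : ℕ) ≤ K₁ * e s ^ (3 / 4 : ℝ) + K₂ := by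
    filter_upwards [hsl] with s hs
    refine hs.trans (le_of_eq ?_)
    simp only [hK₁, hK₂]; ring
  have hvolW : (volume.restrict W) univ = ENNReal.ofReal (β - α) := by
    rw [Measure.restrict_apply_univ, hW, Real.volume_Ioo]
  have hint1 : ∫⁻ s in W, (K₁ * e s ^ (3 / 4 : ℝ) + K₂) =
      K₁ * (∫⁻ s in W, e s ^ (3 / 4 : ℝ)) + K₂ * ENNReal.ofReal (β - α) := by
    rw [lintegral_add_left' ((hemeas.pow_const _).const_mul _), lintegral_const_mul'' _ (hemeas.pow_const _),
      lintegral_const, hvolW]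
  have hmain : ∫⁻ z in W ×ˢ B, ‖u z.1 z.2‖ₑ ^ (3 : ℕ) ≤
      K₁ * (E₀ ^ (3 / 4 : ℝ) * ENNReal.ofReal (β - α) ^ (1 / 4 : ℝ)) + K₂ * ENNReal.ofReal (β - α) := by
    calc ∫⁻ z in W ×ˢ B, ‖u z.1 z.2‖ₑ ^ (3 : ℕ)
        = ∫⁻ s in W, ∫⁻ x in B, ‖u s x‖ₑ ^ (3 : ℕ) := setLIntegral_prod_eq humeas
      _ ≤ ∫⁻ s in W, (K₁ * e s ^ (3 / 4 : ℝ) + K₂) := lintegral_mono_ae hsl'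
      _ = K₁ * (∫⁻ s in W, e s ^ (3 / 4 : ℝ)) + K₂ * ENNReal.ofReal (β - α) := hint1
      _ ≤ K₁ * (E₀ ^ (3 / 4 : ℝ) * ENNReal.ofReal (β - α) ^ (1 / 4 : ℝ)) + K₂ * ENNReal.ofReal (β - α) := by
          gcongr
  refine hmain.trans ?_
  -- absorb the constants into `K = 2^{1/2} max(C^{3/2}, 1)`
  set M : ℝ≥0∞ := max ((C : ℝ≥0∞) ^ (3 / 2 : ℝ)) 1 with hM
  have hC' : (C : ℝ≥0∞) ^ (3 / 2 : ℝ) ≤ M := le_max_left _ _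
  have h1' : (1 : ℝ≥0∞) ≤ M := le_max_right _ _
  have e1 : K₁ * (E₀ ^ (3 / 4 : ℝ) * ENNReal.ofReal (β - α) ^ (1 / 4 : ℝ)) =
      2 ^ (1 / 2 : ℝ) * (C : ℝ≥0∞) ^ (3 / 2 : ℝ) *
        (A₀ ^ (3 / 4 : ℝ) * E₀ ^ (3 / 4 : ℝ) * ENNReal.ofReal (β - α) ^ (1 / 4 : ℝ)) := by
    simp only [hK₁]; ring
  have e2 : K₂ * ENNReal.ofReal (β - α) =
      2 ^ (1 / 2 : ℝ) * 1 * (ENNReal.ofReal (β - α) * (volume B)⁻¹ ^ (1 / 2 : ℝ) * A₀ ^ (3 / 2 : ℝ)) := by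
    simp only [hK₂]; ring
  rw [e1, e2, mul_add]
  exact add_le_add (mul_le_mul' (mul_le_mul' le_rfl hC') le_rfl) (mul_le_mul' (mul_le_mul' le_rfl h1') le_rfl)


end Summit.NavierStokesRegularity.NavierStokesRegularity.Theorems.PowerGaugeEulerLiouville

end
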